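import Summits.CriticalPhenomena.PercolationContinuityZ3.Theorems.SahiMasterFamilyDefectPartition

/-!
# The COMPLEMENT FORM of `Φ` (identity (I5)), every finite index type, every signed model, every order:
# `Φ(f) = Σ_z W^{(z)}(f) − A(f)` with `A(f) = Σ_σ ∏_{c ∈ cyc σ} (1 − E ∏_{i∈c} f_i)`, and the CAP IDENTITY AT EVERY ROOT

Unit `prim-masterthm-p4` (gen 27; crux anchor stmt-CriticalPhenomena-4575, helper work; memo
`run/shared/lean/prim/prim-masterthm/prim-masterthm-p4/P4-GEN27-REPORT.md` §1).  Companion of `…BernsteinPos` (block expansion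
`Φ = Σ_{B ∋ last} (|B|−1)! β_B κ_B`, cap identity `Σ_{B ∋ last} (|B|−1)! κ_B = W` at the LAST root, `BPos`, `mix`),
`…TransportMatching` / `…RuleT` / `…CBar` / `…SideCriterion` (the labelled-permutation COUNTING MODEL of conjecture (B), whose link
to `Φ` — "the complement form (I5), not formalised" — every one of those files had to assume in prose).

THE IDENTITY.  For a real set function `β` on the nonempty subsets of `T = Fin (k+1)` put, in DEFECT variables `1 − β`,
  `A(β) := Σ_{σ ∈ S_{k+1}} ∏_{c ∈ cyc σ} (1 − β_c)`           (`badPoly`, the permutation partition function),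
  `W^{(z)}(β) := Σ_{τ ∈ Sym(T∖z)} ∏_{c ∈ cyc τ} (1 − β_c)`     (`capPoly z`, the CAP polynomial at the root `z`).
**THEOREM (`phiSet_eq_sum_capPoly_sub_badPoly`, every `β`, every `k`):  `Φ_{k+1}(β) = Σ_{z ∈ T} W^{(z)}(β) − A(β)`.**
In the square-free algebra (`t_i² = 0`) this is `exp(−C_β) = exp(C_{1−β})·(1 − Σ_i t_i)` read at `t^T`
(`C_β = Σ_S (|S|−1)! β_S t^S`, `exp(C_1) = Σ_R |R|! t^R = (1 − Σ t_i)^{-1}`); memo BERNSTEIN-INDUCTION.md (I5).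
**THEOREM (`sum_blocks_coRest_eq_capPoly`, the CAP IDENTITY AT EVERY ROOT `z`):  `Σ_{B ∋ z} (|B|−1)!·κ_B(β) = W^{(z)}(β)`**
(the tree had it at `z = last` only, `BernsteinPos.sum_blocks_coRest_eq_W`, through Lieb–Sahi's join absorption; `capPoly_last`
identifies the two).  Both are proved here for Lieb–Sahi's cycle sum over an ARBITRARY finite index type and an arbitrary signed model
(`cycleSum_eq_sum_badSum_sub`, `sum_blocks_coRest_eq_badSum`), which is the form the induction needs.

PROOF (new; elementary, no absorption factors).  (i) SHIFTED MODEL: adjoin to the weight space one point of weight `−1` on which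
every `f_i` equals `1`; all mixed moments drop by one (`ex_shift`), so `A(f) = −(cycle sum of the shifted model)` (`badSum_eq_neg_cycleSum`)
and Lieb–Sahi's block expansion [LiebSahi2021, Prop. 3.4] (`CycleForm.cycleSum_eq_sum_blocks`, any root) transfers to `A`:
`A(f) = Σ_{B ∋ i} (|B|−1)!(1 − e_B)·A(f|_{Bᶜ})` (`badSum_eq_sum_blocks`).  (ii) STRONG INDUCTION on the number of indices
(`cycleSum_eq_sum_badOn_sub`): expand `Φ`, `A` and every `W^{(z)}`, `z ≠ i`, along the cycle through one root `i`; by induction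
`κ_B = A(Bᶜ) − Σ_{z ∈ Bᶜ} A(Bᶜ∖z)` for `B ≠ T`; the three block sums then agree term by term as soon as
`Σ_{B ∋ i} (|B|−1)!·(A(Bᶜ) − Σ_{z∈Bᶜ} A(Bᶜ∖z)) = A(T∖i)` — which is the cap identity at `i`, and which here is the purely
arithmetical convolution identity `Σ_{Q ⊆ K} |Q|!·(x(K∖Q) − Σ_{z ∈ K∖Q} x(K∖Q∖z)) = x(K)` (`sum_powerset_factorial_sub`,
`(1 − Σ t)·exp(C_1) = 1`) applied to `x = A(f|_·)`, `K = T∖i`, `Q = B∖i`.  So the cap identity at every root and the complement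
form come out of ONE induction, for every model.

CONSEQUENCES FOR PAIRS OF FAMILIES (`β = mix 𝒰 𝒱 w = w·1_𝒰 + (1−w)·1_𝒱`, NO hypothesis on `𝒰, 𝒱`): every defect factor is the
BAD-CYCLE WEIGHT `1 − β_c = w[c ∉ 𝒰] + (1−w)[c ∉ 𝒱]` (`one_sub_mix`), so `A(w)` is the all-bad polynomial and `W^{(z)}(w)` the
pointed-all-bad polynomial at `z` of the memos (P4-GEN24 §8, P4-GEN26 §1), both Bernstein-positive (`bpos_badPoly_mix`,
`bpos_capPoly_mix`), and the edge polynomial is their difference: **`P(w) = Σ_z W^{(z)}(w) − A(w)`**, `P + A ≥_B 0`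
(`bpos_phiSet_mix_add_badPoly`).  This is the kernel form of "conjecture (B) = all-bad configurations ≤ pointed all-bad
configurations, layer by layer" behind (TM), RULE T, (C̄) and the side criterion; the root-summed identity
`(k+1)·P = Σ_z W^{(z)} + Σ_{B ≠ T} |B|!·γ_B·P_{T∖B}` of `…CBar` combined with it gives `k·P_T = A + Σ_{∅≠B⊊T} |B|! γ_B P_{T∖B}`.
HONEST FRAMING: identities only (for every real set function); conjecture (B), (TM), `UCHullNonneg k` (k ≥ 8), Sahi's `C_k` and the
master theorem remain OPEN.  Axioms standard. [this work]
-/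

noncomputable section

open scoped Classical

namespace Summit.CriticalPhenomena.PercolationContinuityZ3.Theorems

namespace ComplementForm

open Finset Function Equiv
open Literature.Combinatorics.Sahi2008
open Literature.Combinatorics.Sahi2008.CycleForm

variable {α : Type*} [Fintype α]

section General

variable {κ : Type*} [Fintype κ] [DecidableEq κ]

/-! ### The complement form `Φ = Σ_z A(∖z) − A` and the cap identity, on every finite index type -/

/-- Expansion of the punctured partition function `A(f|_{∖z})` along the cycle through a second index `i ≠ z`, written
with blocks of the ambient type. [this work] -/
theorem badOn_erase_eq_sum_blocks (μ : α → ℝ) (f : κ → α → ℝ) {i z : κ} (hz : z ≠ i) :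
    badOn μ f (univ.erase z) = ∑ B ∈ univ.filter (fun B : Finset κ => i ∈ B ∧ z ∉ B),
      ((B.card - 1).factorial : ℝ) * ((1 - ex μ (fun x => ∏ j ∈ B, f j x)) *
        badOn μ f ((univ \ B).erase z)) := by
  have hi : i ∈ univ.erase z := mem_erase.2 ⟨hz.symm, mem_univ _⟩
  unfold badOn
  rw [badSum_eq_sum_blocks μ (fun j : {x // x ∈ univ.erase z} => f j) ⟨i, hi⟩]
  refine sum_nbij' (fun B' => B'.map (Embedding.subtype _)) (fun B => B.subtype _) ?_ ?_ ?_ ?_ ?_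
  · intro B' hB'
    have hiB' : (⟨i, hi⟩ : {x // x ∈ univ.erase z}) ∈ B' := (mem_filter.1 hB').2
    refine mem_filter.2 ⟨mem_univ _, mem_map.2 ⟨⟨i, hi⟩, hiB', rfl⟩, fun hzB => ?_⟩
    have := property_of_mem_map_subtype B' hzB
    exact (mem_erase.1 this).1 rfl
  · intro B hB
    obtain ⟨hiB, _⟩ := (mem_filter.1 hB).2
    exact mem_filter.2 ⟨mem_univ _, mem_subtype.2 hiB⟩
  · intro B' _
    ext y
    simp only [mem_subtype, mem_map, Embedding.coe_subtype]
    constructor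
    · rintro ⟨a, ha, hay⟩; rwa [← Subtype.ext hay]
    · intro hy; exact ⟨y, hy, rfl⟩
  · intro B hB
    obtain ⟨_, hzB⟩ := (mem_filter.1 hB).2
    exact subtype_map_of_mem fun x hx => mem_erase.2 ⟨fun h => hzB (h ▸ hx), mem_univ _⟩
  · intro B' _
    rw [card_map, ex_prod_subtype, badSum_notMem_eq_badOn μ (fun j : {x // x ∈ univ.erase z} => f j) B',
      badOn_restrict μ f _ (univ \ B')]
    congr 3
    ext y
    simp only [mem_map, mem_sdiff, mem_univ, true_and, mem_erase, Embedding.coe_subtype]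
    constructor
    · rintro ⟨a, ha, rfl⟩
      exact ⟨(mem_erase.1 a.2).1, fun ⟨b, hb, hba⟩ => ha (by rwa [← Subtype.ext hba])⟩
    · rintro ⟨hyz, hyB⟩
      exact ⟨⟨y, mem_erase.2 ⟨hyz, mem_univ _⟩⟩, fun h => hyB ⟨_, h, rfl⟩, rfl⟩

/-- The block sum of the coefficients `A(Bᶜ) − Σ_{z ∈ Bᶜ} A(Bᶜ ∖ z)` over the blocks through `i` is `A` of the family punctured
at `i` (the elementary identity `(1 − Σ t)·exp(C_1) = 1`, re-indexed by `B ↦ B ∖ i`). [this work] -/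
theorem sum_blocks_sub_eq_badOn_erase (μ : α → ℝ) (f : κ → α → ℝ) (i : κ) :
    ∑ B ∈ univ.filter (fun B : Finset κ => i ∈ B), ((B.card - 1).factorial : ℝ) *
      (badOn μ f (univ \ B) - ∑ z ∈ univ \ B, badOn μ f ((univ \ B).erase z)) = badOn μ f (univ.erase i) := by
  rw [← sum_powerset_factorial_sub (badOn μ f) (univ.erase i)]
  refine sum_nbij' (fun B => B.erase i) (fun Q => insert i Q) ?_ ?_ ?_ ?_ ?_
  · intro B _
    exact mem_powerset.2 (erase_subset_erase _ (subset_univ B))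
  · intro Q _
    exact mem_filter.2 ⟨mem_univ _, mem_insert_self _ _⟩
  · intro B hB
    exact insert_erase (mem_filter.1 hB).2
  · intro Q hQ
    exact erase_insert fun h => (mem_erase.1 (mem_powerset.1 hQ h)).1 rfl
  · intro B hB
    have hiB : i ∈ B := (mem_filter.1 hB).2
    have hset : univ \ B = univ.erase i \ B.erase i := by
      ext y
      simp only [mem_sdiff, mem_univ, true_and, mem_erase]
      constructor
      · intro hy; exact ⟨⟨fun h => hy (h ▸ hiB), trivial⟩, fun h => hy h.2⟩
      · rintro ⟨⟨hyi, _⟩, h⟩ hyB; exact h ⟨hyi, hyB⟩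
    rw [card_erase_of_mem hiB, hset]

/-- **MAIN LEMMA (the complement form, by strong induction on the number of indices).**  For every signed weight `μ`, every
finite index type with `n+1` elements and every family `f`:
`Σ_σ (−1)^{C_σ−1} E_σ(f) = Σ_z A(f|_{∖z}) − A(f)`. [this work] -/
theorem cycleSum_eq_sum_badOn_sub : ∀ (n : ℕ) (κ : Type*) [Fintype κ] [DecidableEq κ],
    Fintype.card κ = n + 1 → ∀ (μ : α → ℝ) (f : κ → α → ℝ),
      cycleSum μ f = (∑ z : κ, badOn μ f (univ.erase z)) - badSum μ f := by
  intro n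
  induction n using Nat.strong_induction_on with
  | _ n ih =>
  intro κ _ _ hcard μ f
  obtain ⟨i⟩ : Nonempty κ := Fintype.card_pos_iff.1 (by omega)
  -- (1) the complementary factors of the blocks through `i`, by the induction hypothesis
  have hco : ∀ B : Finset κ, i ∈ B → coRest μ f B =
      badOn μ f (univ \ B) - ∑ z ∈ univ \ B, badOn μ f ((univ \ B).erase z) := by
    intro B hiB
    by_cases hBu : B = univ
    · subst hBu
      rw [coRest_univ, Finset.sdiff_self, sum_empty, badOn_empty, sub_zero]
    · have hcB : Fintype.card {x // x ∉ B} = (univ \ B).card :=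
        Fintype.card_of_subtype (univ \ B) fun x => by simp
      have h1 : (univ \ B).card = Fintype.card κ - B.card := by rw [card_sdiff_of_subset (subset_univ B), card_univ]
      have h2 : B.card < Fintype.card κ := by
        rw [← card_univ]; exact card_lt_card (ssubset_of_subset_of_ne (subset_univ B) hBu)
      have h3 : 0 < B.card := card_pos.2 ⟨i, hiB⟩
      have hlt : Fintype.card {x // x ∉ B} - 1 < n := by omega
      have hc' : Fintype.card {x // x ∉ B} = (Fintype.card {x // x ∉ B} - 1) + 1 := by omega
      rw [coRest_of_ne_univ _ _ hBu, ih _ hlt {x // x ∉ B} hc' μ (fun j => f j), badSum_notMem_eq_badOn μ f B]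
      have hz : ∀ z' : {x // x ∉ B}, badOn μ (fun j : {x // x ∉ B} => f j) (univ.erase z') =
          badOn μ f ((univ \ B).erase z') := by
        intro z'
        rw [badOn_restrict μ f (fun x => x ∉ B) (univ.erase z')]
        congr 1
        ext y
        simp only [mem_map, mem_erase, mem_univ, and_true, mem_sdiff, true_and, Embedding.coe_subtype]
        constructor
        · rintro ⟨a, ha, rfl⟩; exact ⟨fun h => ha (Subtype.ext h), a.2⟩
        · rintro ⟨hyz, hyB⟩; exact ⟨⟨y, hyB⟩, fun h => hyz (congrArg Subtype.val h), rfl⟩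
      simp only [hz]
      rw [← sum_subtype (univ \ B) (p := fun x => x ∉ B) (fun x => by simp)
        (fun z => badOn μ f ((univ \ B).erase z))]
      ring
  -- (2) `A(f)` along the blocks through `i`
  have hA : badSum μ f = ∑ B ∈ univ.filter (fun B : Finset κ => i ∈ B), ((B.card - 1).factorial : ℝ) *
      ((1 - ex μ (fun x => ∏ j ∈ B, f j x)) * badOn μ f (univ \ B)) := by
    rw [badSum_eq_sum_blocks μ f i]
    exact sum_congr rfl fun B _ => by rw [badSum_notMem_eq_badOn]
  -- (3) the punctured partition functions at `z ≠ i`, along the blocks through `i`, summed over `z`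
  have hW : ∑ z : κ, badOn μ f (univ.erase z) = badOn μ f (univ.erase i) +
      ∑ B ∈ univ.filter (fun B : Finset κ => i ∈ B), ((B.card - 1).factorial : ℝ) *
        ((1 - ex μ (fun x => ∏ j ∈ B, f j x)) * ∑ z ∈ univ \ B, badOn μ f ((univ \ B).erase z)) := by
    rw [← add_sum_erase univ _ (mem_univ i)]
    congr 1
    rw [sum_congr rfl fun z hz => badOn_erase_eq_sum_blocks μ f (i := i) (z := z) (mem_erase.1 hz).1]
    rw [sum_comm' (t' := univ.filter (fun B : Finset κ => i ∈ B)) (s' := fun B => univ \ B)]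
    · exact sum_congr rfl fun B _ => by rw [mul_sum, mul_sum]
    · intro z B
      simp only [mem_erase, mem_univ, and_true, mem_filter, true_and, mem_sdiff]
      constructor
      · rintro ⟨_, hiB, hzB⟩; exact ⟨hzB, hiB⟩
      · rintro ⟨hzB, hiB⟩; exact ⟨fun h => hzB (h ▸ hiB), hiB, hzB⟩
  -- (4) assemble with the cap identity `sum_blocks_sub_eq_badOn_erase`
  rw [cycleSum_eq_sum_blocks μ f i, hW, hA, ← sum_blocks_sub_eq_badOn_erase μ f i, ← sum_add_distrib, ← sum_sub_distrib]
  refine sum_congr rfl fun B hB => ?_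
  rw [hco B (mem_filter.1 hB).2]
  ring

/-- **THEOREM (complement form of Lieb–Sahi's cycle sum, every finite index type).**  On a nonempty finite index type,
`Σ_σ (−1)^{C_σ−1} ∏_{c ∈ cyc σ} E(∏_{i∈c} f_i) = Σ_z A(f|_{∖z}) − A(f)` with `A(g) = Σ_τ ∏_{c ∈ cyc τ} (1 − E(∏_{i∈c} g_i))`. [this work] -/
theorem cycleSum_eq_sum_badSum_sub [Nonempty κ] (μ : α → ℝ) (f : κ → α → ℝ) :
    cycleSum μ f = (∑ z : κ, badSum μ (fun j : {x // x ≠ z} => f j)) - badSum μ f := by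
  obtain ⟨n, hn⟩ : ∃ n, Fintype.card κ = n + 1 :=
    ⟨Fintype.card κ - 1, (Nat.succ_pred_eq_of_pos Fintype.card_pos).symm⟩
  rw [cycleSum_eq_sum_badOn_sub n κ hn μ f]
  simp only [badSum_ne_eq_badOn]

/-- **THE CAP IDENTITY AT EVERY ROOT, every finite index type**: `Σ_{B ∋ i} (|B|−1)!·κ_B = A(f|_{∖i})` — the complementary factors
of the blocks through `i` sum to the permutation partition function, in defect variables, of the family punctured at `i`
(the tree's `BernsteinPos.sum_blocks_coRest_eq_W` is the case `κ = Fin (k+1)`, `i = last`, `μ = realW β`). [this work] -/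
theorem sum_blocks_coRest_eq_badSum (μ : α → ℝ) (f : κ → α → ℝ) (i : κ) :
    ∑ B ∈ univ.filter (fun B : Finset κ => i ∈ B), ((B.card - 1).factorial : ℝ) * coRest μ f B =
      badSum μ (fun j : {x // x ≠ i} => f j) := by
  rw [badSum_ne_eq_badOn, ← sum_blocks_sub_eq_badOn_erase μ f i]
  refine sum_congr rfl fun B hB => ?_
  have hiB : i ∈ B := (mem_filter.1 hB).2
  congr 1
  by_cases hBu : B = univ
  · subst hBu
    rw [coRest_univ, Finset.sdiff_self, sum_empty, badOn_empty, sub_zero]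
  · haveI : Nonempty {x // x ∉ B} := by
      obtain ⟨y, hy⟩ : ∃ y, y ∉ B := not_forall.1 (mt eq_univ_iff_forall.2 hBu)
      exact ⟨⟨y, hy⟩⟩
    rw [coRest_of_ne_univ _ _ hBu, cycleSum_eq_sum_badSum_sub, badSum_notMem_eq_badOn μ f B]
    have hz : ∀ z' : {x // x ∉ B}, badSum μ (fun j : {y : {x // x ∉ B} // y ≠ z'} => f j) =
        badOn μ f ((univ \ B).erase z') := by
      intro z'
      rw [badSum_ne_eq_badOn μ (fun j : {x // x ∉ B} => f j) z', badOn_restrict μ f (fun x => x ∉ B) (univ.erase z')]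
      congr 1
      ext y
      simp only [mem_map, mem_erase, mem_univ, and_true, mem_sdiff, true_and, Embedding.coe_subtype]
      constructor
      · rintro ⟨a, ha, rfl⟩; exact ⟨fun h => ha (Subtype.ext h), a.2⟩
      · rintro ⟨hyz, hyB⟩; exact ⟨⟨y, hyB⟩, fun h => hyz (congrArg Subtype.val h), rfl⟩
    simp only [hz]
    rw [← sum_subtype (univ \ B) (p := fun x => x ∉ B) (fun x => by simp) (fun z => badOn μ f ((univ \ B).erase z))]
    ring

end General

section SetFunctions

/-! ### Set functions on `Fin (k+1)`: the complement form of `Φ`, the cap polynomials at every root -/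

open PrincipalCapBeta (phiSet realF realW)
open BernsteinPos

variable {k : ℕ}

/-- `A(β) := Σ_{σ ∈ S_{k+1}} ∏_{c ∈ cyc σ} (1 − β_c)` — the permutation partition function of a real set function in defect
variables. [this work] -/
def badPoly (β : Finset (Fin (k + 1)) → ℝ) : ℝ :=
  ∑ σ : Perm (Fin (k + 1)), ∏ B ∈ orbits σ, (1 - β B)

/-- `W^{(z)}(β) := Σ_{τ ∈ S_k} ∏_{c ∈ cyc τ} (1 − β_{c ↪ z})` — the CAP polynomial at the root `z`: the partition function of the set
function restricted to the complement of `z` (a cycle `c ⊆ Fin k` is read in `Fin (k+1)` through `Fin.succAbove z`). [this work] -/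
def capPoly (z : Fin (k + 1)) (β : Finset (Fin (k + 1)) → ℝ) : ℝ :=
  ∑ τ : Perm (Fin k), ∏ B ∈ orbits τ, (1 - β (B.map (Fin.succAboveEmb z)))

/-- The moments of the canonical signed model are the values of `β`. [this work] -/
theorem ex_realW_prod_fun (β : Finset (Fin (k + 1)) → ℝ) (B : Finset (Fin (k + 1))) :
    ex (realW β) (fun x => ∏ i ∈ B, realF i x) = β B := by
  have e1 : (fun x => ∏ i ∈ B, realF i x) = ∏ i ∈ B, (realF i : Finset (Fin (k + 1)) → ℝ) :=
    funext fun x => (Finset.prod_apply x B _).symm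
  rw [e1, PrincipalCapBeta.ex_realW_prod]

/-- `A` of the canonical signed model is `badPoly`. [this work] -/
theorem badSum_realW (β : Finset (Fin (k + 1)) → ℝ) : badSum (realW β) realF = badPoly β := by
  unfold badSum badPoly
  simp only [ex_realW_prod_fun]

/-- `A` of the canonical signed model punctured at `z` is the cap polynomial at `z`. [this work] -/
theorem badSum_realW_ne (β : Finset (Fin (k + 1)) → ℝ) (z : Fin (k + 1)) :
    badSum (realW β) (fun j : {x // x ≠ z} => realF (j : Fin (k + 1))) = capPoly z β := by
  rw [← badSum_comp_equiv (realW β) (finSuccAboveEquiv z) (fun j : {x // x ≠ z} => realF (j : Fin (k + 1)))]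
  unfold badSum capPoly
  refine sum_congr rfl fun τ _ => prod_congr rfl fun B _ => ?_
  congr 1
  have e1 : (fun x => ∏ i ∈ B, realF ((finSuccAboveEquiv z i : {x // x ≠ z}) : Fin (k + 1)) x) =
      fun x => ∏ i ∈ B.map (Fin.succAboveEmb z), realF i x := by
    funext x
    rw [prod_map]
    simp only [finSuccAboveEquiv_apply, Fin.coe_succAboveEmb]
  rw [e1, ex_realW_prod_fun]

/-- **THE COMPLEMENT FORM OF `Φ` (identity (I5)), every real set function, every order:**
`Φ_{k+1}(β) = Σ_{z} W^{(z)}(β) − A(β)` — `Φ` is the sum of the cap polynomials over all roots minus the permutation partition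
function; in the square-free algebra: `exp(−C_β) = exp(C_{1−β})·(1 − Σ_i t_i)`. [this work] -/
theorem phiSet_eq_sum_capPoly_sub_badPoly (β : Finset (Fin (k + 1)) → ℝ) :
    phiSet (k + 1) β = (∑ z : Fin (k + 1), capPoly z β) - badPoly β := by
  rw [PrincipalCapBeta.phiSet_eq_sahiE_real, sahiE_eq_cycleSum (realW β) (Nat.succ_le_succ (Nat.zero_le k)),
    cycleSum_eq_sum_badSum_sub, badSum_realW]
  simp only [badSum_realW_ne]

/-- The cap polynomial at the LAST root is the tree's `W(β) = Σ_{σ ∈ S_k} ∏_c (1 − β_{c.map castSucc})` of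
`BernsteinPos.sum_blocks_coRest_eq_W`. [this work] -/
theorem capPoly_last (β : Finset (Fin (k + 1)) → ℝ) :
    capPoly (Fin.last k) β = ∑ σ : Perm (Fin k), ∏ B ∈ orbits σ, (1 - β (B.map Fin.castSuccEmb)) := by
  unfold capPoly
  refine sum_congr rfl fun σ _ => prod_congr rfl fun B _ => ?_
  congr 2
  ext x
  simp only [mem_map, Fin.coe_succAboveEmb, Fin.succAbove_last, Fin.coe_castSuccEmb]

/-- **The cap identity at EVERY root** for real set functions: `Φ_{k+1}(cap_z β) = W^{(z)}(β)` in block form —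
`Σ_{B ∋ z} (|B|−1)!·κ_B(β) = W^{(z)}(β)`. [this work] -/
theorem sum_blocks_coRest_eq_capPoly (β : Finset (Fin (k + 1)) → ℝ) (z : Fin (k + 1)) :
    ∑ B ∈ univ.filter (fun B : Finset (Fin (k + 1)) => z ∈ B),
      ((B.card - 1).factorial : ℝ) * coRest (realW β) realF B = capPoly z β := by
  rw [sum_blocks_coRest_eq_badSum, badSum_realW_ne]

/-- `Φ_{k+1}(β) + A(β) = Σ_z W^{(z)}(β)`. [this work] -/
theorem phiSet_add_badPoly (β : Finset (Fin (k + 1)) → ℝ) :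
    phiSet (k + 1) β + badPoly β = ∑ z : Fin (k + 1), capPoly z β := by
  rw [phiSet_eq_sum_capPoly_sub_badPoly]; ring

/-! ### Two-family mixtures: every defect factor is a bad-cycle weight -/

variable {n : ℕ}

/-- Along a two-family mixture the defect of a set is the weight of the labels for which it is BAD:
`1 − β_S = w·[S ∉ 𝒰] + (1−w)·[S ∉ 𝒱]`. [this work] -/
theorem one_sub_mix (𝒰 𝒱 : Finset (Finset (Fin n))) (w : ℝ) (S : Finset (Fin n)) :
    1 - mix 𝒰 𝒱 w S = w * (if S ∉ 𝒰 then 1 else 0) + (1 - w) * (if S ∉ 𝒱 then 1 else 0) := by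
  unfold mix
  by_cases hU : S ∈ 𝒰 <;> by_cases hV : S ∈ 𝒱 <;>
    simp only [hU, hV, if_true, if_false, not_true_eq_false, not_false_eq_true, mul_one, mul_zero] <;> ring

/-- `A(w·1_𝒰 + (1−w)·1_𝒱)` — the ALL-BAD polynomial of the pair: `Σ_σ ∏_{c} (w[c ∉ 𝒰] + (1−w)[c ∉ 𝒱])` — is Bernstein-positive
of degree `k+1`. [this work] -/
theorem bpos_badPoly_mix (𝒰 𝒱 : Finset (Finset (Fin (k + 1)))) :
    BPos (k + 1) (fun w => badPoly (mix 𝒰 𝒱 w)) := by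
  unfold badPoly
  refine BPos.sum univ (fun σ w => ∏ B ∈ orbits σ, (1 - mix 𝒰 𝒱 w B)) fun σ _ => ?_
  exact (BPos.prod (orbits σ) (fun B w => 1 - mix 𝒰 𝒱 w B) fun B _ => UCBernsteinNested.bpos_one_sub_mix' 𝒰 𝒱 B).mono
    (card_orbits_le σ)

/-- The cap polynomial `W^{(z)}(w·1_𝒰 + (1−w)·1_𝒱)` — the POINTED ALL-BAD polynomial at `z` — is Bernstein-positive of degree `k`,
at every root and for every pair of families. [this work] -/
theorem bpos_capPoly_mix (𝒰 𝒱 : Finset (Finset (Fin (k + 1)))) (z : Fin (k + 1)) :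
    BPos k (fun w => capPoly z (mix 𝒰 𝒱 w)) := by
  unfold capPoly
  refine BPos.sum univ (fun τ w => ∏ B ∈ orbits τ, (1 - mix 𝒰 𝒱 w (B.map (Fin.succAboveEmb z)))) fun τ _ => ?_
  exact (BPos.prod (orbits τ) (fun B w => 1 - mix 𝒰 𝒱 w (B.map (Fin.succAboveEmb z)))
    fun B _ => UCBernsteinNested.bpos_one_sub_mix' 𝒰 𝒱 _).mono (card_orbits_le τ)

/-- **The edge polynomial in complement form**: for every pair of families (no hypothesis),
`P(w) := Φ_{k+1}(w·1_𝒰 + (1−w)·1_𝒱) = Σ_z W^{(z)}(w) − A(w)` — pointed all-bad weight minus all-bad weight; hence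
`P + A = Σ_z W^{(z)}` is Bernstein-positive of degree `k+1`: **`P ≥_B −A`** and the all-bad polynomial bounds the negative part of
every edge polynomial. [this work] -/
theorem bpos_phiSet_mix_add_badPoly (𝒰 𝒱 : Finset (Finset (Fin (k + 1)))) :
    BPos (k + 1) (fun w => phiSet (k + 1) (mix 𝒰 𝒱 w) + badPoly (mix 𝒰 𝒱 w)) := by
  refine (BPos.sum univ (fun z w => capPoly z (mix 𝒰 𝒱 w)) fun z _ => (bpos_capPoly_mix 𝒰 𝒱 z).mono
    (Nat.le_succ k)).congr fun w => ?_
  rw [phiSet_add_badPoly]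

end SetFunctions
end ComplementForm

end Summit.CriticalPhenomena.PercolationContinuityZ3.Theorems
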